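import Literature.Geometry.Kaehler.ComplexTorusIntegralHardLefschetzDegreeThree
import HarnessLib

/-!
# The cokernel of the divided power `θ^{[g−3]} : H³(X, ℤ) → H^{2g−3}(X, ℤ)` on a principally polarised
# complex torus is `H¹(X, ℤ) ⊗ ℤ/(g−2) ≅ (ℤ/(g−2))^{2g}`, induced by `θ^{[g−2]} ∧ (−) : H¹(X, ℤ) → H^{2g−3}(X, ℤ)`

Layer `Literature/Geometry/Kaehler`, namespace `Literature.Geometry.Kaehler.ComplexTorus`; lane `lit-hodgefound` (Track 2
foundations library), seat p09, generation 38, row g38-#1. THEOREMS ONLY (0 definitions); no named fact, net debt 0. Sequel of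
g37-#2 `ComplexTorusIntegralHardLefschetzDegreeThree` (the exact index `[H^{2g−3}(X, ℤ) : θ^{∧(g−3)} ∧ H³(X, ℤ)]`, through the
free-letter bases of `H³(X, ℤ)` and `H^{2g−3}(X, ℤ)` in which `θ^{∧(g−3)} ∧ (−)` is block diagonal) and the degree-three analogue of
g35-#4 `ComplexTorusIntegralHardLefschetzDegreeTwoCokernel` (`coker θ^{[g−2]}` on `H²(X, ℤ)` is `ℤ/(g−1)`, generated by the minimal class).

Sources (the statements being combined and made precise over `ℤ`):

* Lange 2023 §5.4.1 Thm. 5.4.1 (hard Lefschetz, PDF p. 275: "`L^{n−r} : Hʳ(M, ℂ) → H^{2n−r}(M, ℂ)` is an isomorphism") and (5.22)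
  ("the Lefschetz operator `L` is defined over `ℤ`"); Voisin 2002 §6.2.3 Thm. 6.25 (PDF p. 125), §7.1.2 (PDF p. 134 L31);
* Lange 2023 §2.5.3 Lemma 2.5.14 / Thm. 2.5.16 / Cor. 2.5.17 (PDF p. 135: `θ = Σ d_ν dx_{λ_ν} ∧ dx_{μ_ν}` on a symplectic basis and
  `∧^q θ = q! Σ_{#T = q} (∏_{ν ∈ T} d_ν) ω_T` — so the divided powers `θ^{[q]} := θ^{∧q}/q!` are INTEGRAL classes, g35-#1 §6), §4.2
  Poincaré's formula (PDF p. 204) and §4.7.1 Cor. 4.7.2 (PDF p. 229); §1.1.3 Exercise 1.1.6 (8) (`H^k(X, ℤ) = ∧^k H¹(X, ℤ)`, rank `C(2g, k)`).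

Setting (`g = j + 3`, symplectic enumeration `e₀` of type `d₁ ∣ ⋯ ∣ d_g` for the Riemann form `η`, `θ = ofRealForm η`):
`S := θ^{∧(g−3)} ∧ H³(X, ℤ) ≤ N := (g−3)! · H^{2g−3}(X, ℤ)` (`θ^{∧q} ∧ Hᵏ(X, ℤ) ⊆ q!·H^{2q+k}(X, ℤ)`, g35-#1 §6), so `N/S` is the cokernel of
the divided power `θ^{[g−3]} = θ^{∧(g−3)}/(g−3)!` on the lattices; and with `γ := θ^{[g−2]} ∈ H^{2g−4}(X, ℤ)` (`θ^{∧(g−2)} = (g−2)! · γ`) put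
`m := (g−3)! · γ = θ^{∧(g−2)}/(g−2)` and `M := m ∧ H¹(X, ℤ) ≤ N`. This file proves:

* §1 `[N : S] = ∏_{(x_a,x_b,x_c), a<b<c} ∏_{ν ∉ {a,b,c}} d_ν · ∏_x (∏_{ν ≠ a(x)} d_ν)^{g−3} (g−2)` for every type; **`(g−2)^{2g}` for a principal
  polarisation** (the index of g37-#2 divided by `[H^{2g−3}(X, ℤ) : (g−3)!·H^{2g−3}(X, ℤ)] = ((g−3)!)^{C(2g,3)}`);
* §2 the one-free-letter expansion `θ^{∧(g−2)} ∧ dx_x = (g−2)! Σ_{i' ≠ a(x)} (∏_{ν ∉ {a(x), i'}} d_ν) dx_{(λμ)_{{a(x),i'}ᶜ} ++ (x)}` (the `(g−2)`-sets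
  through `a(x)` die) — in the free-letter basis of g37-#2, `m ∧ dx_x` is `(g−3)!` times the SUM of the `g − 1` target words with free letter `x`;
* §3 `θ^{∧j} ∧ (θ ∧ φ) = (g−2) · (m ∧ φ)` (re-bracketing), so `(g−2) · M ≤ S` and `θ^{∧(g−2)} ∧ H¹(X, ℤ) ⊆ θ^{∧(g−3)} ∧ H³(X, ℤ)` for every type;
* §4 (principal) **`m ∧ φ ∈ S ⟺ φ ∈ (g−2) · H¹(X, ℤ)`** for `φ ∈ H¹(X, ℤ)`: the coordinate SUM over the pair block of a letter `x` (the
  `g − 1` target words `(λμ)_{{a(x),i'}ᶜ} ++ (x)`) is `≡ 0 mod (g−3)!(g−2)` on `S` (each column of the pair block `B_x = (g−3)!(J − 1)` of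
  g37-#2 has sum `(g−3)!(g−2)`, the free words contribute nothing), while on `m ∧ φ` it is `(g−3)!(g−1) · φ_x` (§2); `gcd(g−1, g−2) = 1`;
* §5 (principal) **`N = S ⊔ M`**, i.e. `(g−3)! · H^{2g−3}(X, ℤ) = θ^{∧(g−3)} ∧ H³(X, ℤ) + (g−3)! · θ^{[g−2]} ∧ H¹(X, ℤ)` (both `[N : S]` and
  `[S ⊔ M : S] = [H¹(X, ℤ) : (g−2)H¹(X, ℤ)]` are `(g−2)^{2g}`), the exponent `(g−2)! · H^{2g−3}(X, ℤ) ⊆ θ^{∧(g−3)} ∧ H³(X, ℤ)`, and `M ⊄ S` for `g ≥ 4`;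
* §6 (principal) **`coker(θ^{[g−3]} : H³(X, ℤ) → H^{2g−3}(X, ℤ)) = N/S ≃+ H¹(X, ℤ)/(g−2)·H¹(X, ℤ) ≃+ (ℤ/(g−2))^{2g}`, the first isomorphism
  induced by `φ ↦ m ∧ φ = (g−3)! · θ^{[g−2]} ∧ φ`**;
* §7 basis-free forms (any presentation of a polarised torus of type `d`; principal polarisations).

Examples: p.p. abelian fourfold (`j = 1`, `m = θ^{∧2}/2 = θ^{[2]}`): **`H⁵(X, ℤ) = θ ∧ H³(X, ℤ) + θ^{[2]} ∧ H¹(X, ℤ)` and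
`H⁵(X, ℤ)/θ ∧ H³(X, ℤ) ≅ H¹(X, ℤ)/2 H¹(X, ℤ) ≅ (ℤ/2)^8`** (g37-#2 gave the order `2^8`); p.p. fivefold (`j = 2`): `2·H⁷(X, ℤ) = θ² ∧ H³(X, ℤ) +
(θ³/3) ∧ H¹(X, ℤ)`, `coker θ^{[2]}|_{H³} ≅ (ℤ/3)^{10}`; p.p. threefold (`j = 0`): everything is trivial (`θ^{[0]} = 1`).

## References

* [cite: Lange2023AbelianVarietiesComplex, §5.4.1 Thm. 5.4.1 and (5.22) (PDF p. 275); §2.5.3 Lemma 2.5.14, Thm. 2.5.16, Cor. 2.5.17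
  (PDF p. 135); §4.2 Poincaré's formula (PDF p. 204); §4.7.1 Cor. 4.7.2 (PDF p. 229); §1.5.1 (types, PDF p. 51); §2.1.1 (principal);
  §1.1.3 Exercise 1.1.6 (8) and Lemma 1.1.17; §1.1.4 Prop. 1.1.20]
* [cite: VoisinHodgeI2002, §6.2.3 Thm. 6.25 (PDF p. 125); §7.1.2 (PDF p. 134 L31); §7.2.2 (PDF p. 142 L10)]
* [cite: Warner1983, 2.6 (associativity and graded commutativity of `∧`)]
-/

noncomputable section

open Module Function
open Literature.LinearAlgebra.Alternating

namespace Literature.Geometry.Kaehler.ComplexTorus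

section DegreeThreeCokernel

variable {ι : Type*} [Fintype ι] [DecidableEq ι] {E : Type*} [NormedAddCommGroup E] [NormedSpace ℂ E]
  (Φ : (ι → ℝ) ≃L[ℝ] E) {j : ℕ} {e₀ : Fin (j + 3) ⊕ Fin (j + 3) ≃ ι} {η : E [⋀^Fin 2]→L[ℝ] ℝ} {d : Fin (j + 3) → ℕ}

/-! ## §0 Casts -/

omit [Fintype ι] [DecidableEq ι] in
/-- Reindexing a lattice monomial along an equation of lengths. [folklore] -/
private theorem latMonomial_comp_finCast₃₈ {m n : ℕ} (h : m = n) (w : Fin n → ι) :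
    latMonomial Φ m (w ∘ Fin.cast h) = (latMonomial Φ n w).domDomCongr (finCongr h.symm) := by
  subst h; rfl

omit [Fintype ι] [DecidableEq ι] in
/-- The target words of the free-letter basis of `H^{2g−3}(X, ℤ)` (g37-#2), written at length `2(j+1)+1 = 2j+3`: the reindexing
between the two spellings of the length is the identity. [folklore] -/
private theorem latMonomial_comp_finCast_two_mul_succ₃₈ (hc : 2 * j + 3 = 2 * (j + 1) + 1) (w : Fin (2 * (j + 1) + 1) → ι) :
    latMonomial Φ (2 * j + 3) (w ∘ Fin.cast hc) = latMonomial Φ (2 * (j + 1) + 1) w := by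
  rw [latMonomial_comp_finCast₃₈ Φ hc]
  rfl

/-- `Σ_{k' : Fin (j+2)} [k' ≠ k] · c = (j+1) · c`. [folklore] -/
private theorem sum_ite_eq_zero_else₃₈ (k : Fin (j + 2)) (c : ℤ) :
    ∑ k' : Fin (j + 2), (if k' = k then (0 : ℤ) else c) = (j + 1) * c := by
  have hcard : (Finset.univ.erase k).card = j + 1 := by
    rw [Finset.card_erase_of_mem (Finset.mem_univ k), Finset.card_univ, Fintype.card_fin]
    rfl
  rw [← Finset.add_sum_erase _ _ (Finset.mem_univ k), if_pos rfl, zero_add,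
    Finset.sum_congr rfl (fun k' hk' ↦ if_neg (Finset.ne_of_mem_erase hk')), Finset.sum_const, hcard, nsmul_eq_mul]
  push_cast
  ring

/-! ## §1 The index of the divided power: `[(g−3)! · H^{2g−3}(X, ℤ) : θ^{∧(g−3)} ∧ H³(X, ℤ)]` -/

omit [DecidableEq ι] in
/-- `[H^{2j+3}(X, ℤ) : j! · H^{2j+3}(X, ℤ)] = (j!)^{C(2g, 3)}` (`rk H^{2g−3}(X, ℤ) = C(2g, 2g−3) = C(2g, 3)`, `g = j + 3`; Mathlib's
`AddSubgroup.relIndex_map_nsmul`). [cite: Lange2023AbelianVarietiesComplex, §1.1.3 Exercise 1.1.6 (8)] -/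
theorem relIndex_map_nsmul_factorial_integralForms_three (e : Fin (2 * (j + 3)) ≃ ι) :
    ((integralForms Φ (2 * j + 3)).map (nsmulAddMonoidHom j.factorial)).relIndex (integralForms Φ (2 * j + 3)) =
      j.factorial ^ (2 * (j + 3)).choose 3 := by
  haveI := free_integralForms Φ (2 * j + 3)
  haveI := finite_integralForms Φ (2 * j + 3)
  rw [AddSubgroup.relIndex_map_nsmul]
  congr 1
  refine (finrank_integralForms_eq_choose Φ (2 * j + 3)).trans ?_
  rw [← Fintype.card_congr e, Fintype.card_fin, show 2 * (j + 3) = (2 * j + 3) + 3 by ring, Nat.choose_symm_add]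

/-- **The index of the cokernel of the divided power `θ^{[g−3]}` on `H³(X, ℤ)`, any type**: for a symplectic enumeration of type
`d = (d₁, …, d_g)` (`g = j + 3`), with `S = θ^{∧j} ∧ H³(X, ℤ) ≤ N = j! · H^{2j+3}(X, ℤ)` (g35-#1 §6),
`[N : S] = ∏_{(x_a,x_b,x_c), a<b<c} ∏_{ν ∉ {a,b,c}} d_ν · ∏_x (∏_{ν ≠ a(x)} d_ν)^j (j+1)` — the index of g37-#2 divided by
`[H^{2j+3}(X, ℤ) : N] = (j!)^{C(2g,3)}` (`#A + (g−1)·2g = C(2g, 3)` counted through the free-letter basis of `H³(X, ℤ)`).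
[cite: Lange2023AbelianVarietiesComplex, §5.4.1 Thm. 5.4.1 and (5.22) (PDF p. 275); §2.5.3 Thm. 2.5.16 (PDF p. 135); §1.1.3 Exercise 1.1.6 (8)] [cite: VoisinHodgeI2002, §7.1.2 (PDF p. 134 L31)] -/
theorem IsSymplecticEnum.relIndex_map_wedgePow_wedge_map_nsmul_three (h : IsSymplecticEnum Φ e₀ η d)
    (hη : IsRiemannForm Φ η) :
    ((integralForms Φ 3).map (AddMonoidHom.mk'
        (fun x : E [⋀^Fin 3]→L[ℝ] ℂ ↦ (wedgePow (ofRealForm η) j).wedge x)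
        (ContinuousAlternatingMap.wedge_add_right _))).relIndex
      ((integralForms Φ (2 * j + 3)).map (nsmulAddMonoidHom j.factorial)) =
      (∏ u : {u : Fin 3 → Fin (j + 3) ⊕ Fin (j + 3) // Sum.elim id id (u 0) < Sum.elim id id (u 1) ∧ Sum.elim id id (u 1) < Sum.elim id id (u 2)},
          ∏ ν ∈ (Finset.univ.image fun m ↦ Sum.elim id id (u.1 m))ᶜ, d ν) *
        ∏ x : Fin (j + 3) ⊕ Fin (j + 3), ((∏ ν ∈ ({Sum.elim id id x} : Finset (Fin (j + 3)))ᶜ, d ν) ^ j * (j + 1)) := by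
  classical
  have hle₁ := h.map_wedgePow_wedge_integralForms_le_map_nsmul Φ j 3
  have hle₂ : (integralForms Φ (2 * j + 3)).map (nsmulAddMonoidHom j.factorial) ≤ integralForms Φ (2 * j + 3) := by
    rintro _ ⟨x, hx, rfl⟩
    exact AddSubgroup.nsmul_mem _ hx _
  have hmul := AddSubgroup.relIndex_mul_relIndex _ _ _ hle₁ hle₂
  rw [relIndex_map_nsmul_factorial_integralForms_three Φ (ilvEnum e₀),
    h.relIndex_map_wedgePow_wedge_integralForms_three_hardLefschetz Φ hη] at hmul
  -- `#A + (g−1) · 2g = C(2g, 3)`: the index type of the free-letter basis of `H³(X, ℤ)` (g37-#2) has `rk H³ = C(2g, 3)` elements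
  letI : LinearOrder ι := linearOrderOfOrientation (ilvEnum e₀)
  obtain ⟨b₃, -, -⟩ := exists_basis_integralForms_three_freeLetter Φ e₀
  have hK : Fintype.card {u : Fin 3 → Fin (j + 3) ⊕ Fin (j + 3) // Sum.elim id id (u 0) < Sum.elim id id (u 1) ∧ Sum.elim id id (u 1) < Sum.elim id id (u 2)} +
      (j + 2) * (2 * (j + 3)) = (2 * (j + 3)).choose 3 := by
    have h2 := (Module.finrank_eq_card_basis b₃).symm.trans (finrank_integralForms_eq_choose Φ 3)
    rw [← Fintype.card_congr (ilvEnum e₀), Fintype.card_fin, Fintype.card_sum, Fintype.card_prod, Fintype.card_fin,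
      Fintype.card_sum, Fintype.card_fin, ← two_mul] at h2
    exact h2
  -- split off the factorials: `∏_u (j! P_u) · ∏_x (j!^{j+2} Q_x (j+1)) = j!^{C(2g,3)} · (∏_u P_u · ∏_x Q_x (j+1))`
  have hsplit : (∏ u : {u : Fin 3 → Fin (j + 3) ⊕ Fin (j + 3) // Sum.elim id id (u 0) < Sum.elim id id (u 1) ∧ Sum.elim id id (u 1) < Sum.elim id id (u 2)},
          (j.factorial * ∏ ν ∈ (Finset.univ.image fun m ↦ Sum.elim id id (u.1 m))ᶜ, d ν)) *
        ∏ x : Fin (j + 3) ⊕ Fin (j + 3),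
          (j.factorial ^ (j + 2) * (∏ ν ∈ ({Sum.elim id id x} : Finset (Fin (j + 3)))ᶜ, d ν) ^ j * (j + 1)) =
      ((∏ u : {u : Fin 3 → Fin (j + 3) ⊕ Fin (j + 3) // Sum.elim id id (u 0) < Sum.elim id id (u 1) ∧ Sum.elim id id (u 1) < Sum.elim id id (u 2)},
          ∏ ν ∈ (Finset.univ.image fun m ↦ Sum.elim id id (u.1 m))ᶜ, d ν) *
        ∏ x : Fin (j + 3) ⊕ Fin (j + 3), ((∏ ν ∈ ({Sum.elim id id x} : Finset (Fin (j + 3)))ᶜ, d ν) ^ j * (j + 1))) *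
        j.factorial ^ (2 * (j + 3)).choose 3 := by
    rw [Finset.prod_mul_distrib, Finset.prod_const, Finset.card_univ,
      Finset.prod_congr rfl (fun (x : Fin (j + 3) ⊕ Fin (j + 3)) _ ↦
        mul_assoc (j.factorial ^ (j + 2)) ((∏ ν ∈ ({Sum.elim id id x} : Finset (Fin (j + 3)))ᶜ, d ν) ^ j) (j + 1)),
      Finset.prod_mul_distrib, Finset.prod_const, Finset.card_univ, ← hK, Fintype.card_sum, Fintype.card_fin]
    ring
  rw [hsplit] at hmul
  exact Nat.eq_of_mul_eq_mul_right (pow_pos (Nat.factorial_pos j) _) hmul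

/-- **Principal type `(1, …, 1)`: `[(g−3)! · H^{2g−3}(X, ℤ) : θ^{∧(g−3)} ∧ H³(X, ℤ)] = (g−2)^{2g}`** (`g = j + 3`): the cokernel of the
divided power `θ^{[g−3]} : H³(X, ℤ) → H^{2g−3}(X, ℤ)` has order `(g−2)^{2g}` — `2^8` for `θ ∧ (−) : H³ → H⁵` on a p.p. abelian fourfold,
`3^{10}` for `θ^{[2]} : H³ → H⁷` on a p.p. fivefold. [cite: Lange2023AbelianVarietiesComplex, §2.1.1 (principal = type `(1, …, 1)`); §5.4.1 Thm. 5.4.1 and (5.22) (PDF p. 275); §2.5.3 Thm. 2.5.16 (PDF p. 135)] -/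
theorem IsSymplecticEnum.relIndex_map_wedgePow_wedge_map_nsmul_three_of_type_one (h : IsSymplecticEnum Φ e₀ η d)
    (hη : IsRiemannForm Φ η) (h1 : ∀ i, d i = 1) :
    ((integralForms Φ 3).map (AddMonoidHom.mk'
        (fun x : E [⋀^Fin 3]→L[ℝ] ℂ ↦ (wedgePow (ofRealForm η) j).wedge x)
        (ContinuousAlternatingMap.wedge_add_right _))).relIndex
      ((integralForms Φ (2 * j + 3)).map (nsmulAddMonoidHom j.factorial)) = (j + 1) ^ (2 * (j + 3)) := by
  rw [h.relIndex_map_wedgePow_wedge_map_nsmul_three Φ hη]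
  simp only [h1, Finset.prod_const_one, one_pow, one_mul, Finset.prod_const, Finset.card_univ, Fintype.card_sum,
    Fintype.card_fin]
  rw [two_mul]

/-! ## §2 One free letter: `θ^{∧(g−2)} ∧ dx_x` on a symplectic basis -/

/-- **One free letter**: for a letter `x` with index `a = a(x)` (`s_a = Fin.succAbove a` enumerates the indices `≠ a`),
`θ^{∧(j+1)} ∧ dx_x = (j+1)! Σ_{k'} (∏_{ν ∈ T'(k')} d_ν) · dx_{(λμ)_{T'(k')} ++ (x)}` with `T'(k') = {a, s_a(k')}ᶜ` (`g = j + 3`, so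
`#T'(k') = j + 1 = g − 2`): in Thm. 2.5.16 `θ^{∧q} ∧ dx_x = q! Σ_{#T = q} (∏_{ν ∈ T} d_ν) dx_{(λμ)_T ++ (x)}` the `(g−2)`-sets `T ∋ a` repeat a
letter, and the surviving ones miss `a` and exactly one further index `s_a(k')`. The interleaved blocks are taken along any chosen
sets `T'(k')` with these elements. [cite: Lange2023AbelianVarietiesComplex, §2.5.3 Lemma 2.5.14 and Thm. 2.5.16 (PDF p. 135); §2.5.3 Cor. 2.5.17 (c)] -/
theorem IsSymplecticEnum.wedgePow_wedge_latMonomial_one_eq_sum (h : IsSymplecticEnum Φ e₀ η d)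
    (x : Fin (j + 3) ⊕ Fin (j + 3)) (T' : Fin (j + 2) → Set.powersetCard (Fin (j + 3)) (j + 1))
    (hT' : ∀ k', ((T' k' : Set.powersetCard (Fin (j + 3)) (j + 1)) : Finset (Fin (j + 3))) =
      ({Sum.elim id id x, (Sum.elim id id x).succAbove k'} : Finset (Fin (j + 3)))ᶜ) :
    (wedgePow (ofRealForm η) (j + 1)).wedge (latMonomial Φ 1 fun _ : Fin 1 ↦ e₀ x) =
      ((j + 1).factorial : ℂ) • ∑ k' : Fin (j + 2), (∏ ν ∈ (T' k' : Finset (Fin (j + 3))), (d ν : ℂ)) •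
        latMonomial Φ (2 * (j + 1) + 1)
          (Fin.append (ilvWord e₀ (Set.powersetCard.ofFinEmbEquiv.symm (T' k'))) (fun _ : Fin 1 ↦ e₀ x)) := by
  classical
  set a : Fin (j + 3) := Sum.elim id id x with ha
  set s : Fin (j + 2) → Fin (j + 3) := a.succAbove with hs
  rw [h.wedgePow_wedge_latMonomial_eq_sum Φ (j + 1) (fun _ : Fin 1 ↦ e₀ x)]
  congr 1
  -- only the `(j+1)`-sets avoiding `a` survive
  rw [← Finset.sum_subset (Finset.filter_subset
    (fun T : Set.powersetCard (Fin (j + 3)) (j + 1) ↦ a ∉ (T : Finset (Fin (j + 3)))) Finset.univ) (fun T _ hT ↦ ?_)]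
  swap
  · rw [Finset.mem_filter, not_and, not_not] at hT
    rw [latMonomial_append_ilvWord_eq_zero_of_index_mem Φ e₀ (p := (0 : Fin 1)) (x := x) rfl
      ((Set.powersetCard.mem_range_ofFinEmbEquiv_symm_iff_mem T _).2
        (Set.powersetCard.mem_coe_iff.1 (hT (Finset.mem_univ _))))]
    ext v; simp
  symm
  -- the bijection `k' ↦ T'(k') = {a, s k'}ᶜ` onto the surviving sets
  refine Finset.sum_bij (fun k' _ ↦ T' k') ?_ ?_ ?_ ?_
  · intro k' _
    rw [Finset.mem_filter, hT']
    simp [hs]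
  · intro k₁ _ k₂ _ heq
    have h1 : (({a, s k₁} : Finset (Fin (j + 3)))ᶜ) = ({a, s k₂} : Finset (Fin (j + 3)))ᶜ := by
      rw [hs, ← hT', ← hT']
      exact congrArg _ heq
    rw [compl_inj_iff] at h1
    have h2 : s k₁ ∈ ({a, s k₂} : Finset (Fin (j + 3))) := by rw [← h1]; simp
    rw [Finset.mem_insert, Finset.mem_singleton] at h2
    rcases h2 with h2 | h2
    · exact absurd h2 (Fin.succAbove_ne a k₁)
    · exact Fin.succAbove_right_injective h2
  · -- surjective: a `(j+1)`-set avoiding `a` misses exactly one further index `s k'`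
    intro T hT
    rw [Finset.mem_filter] at hT
    obtain ⟨-, haT⟩ := hT
    have hcard : ((((T : Finset (Fin (j + 3)))ᶜ).erase a)).card = 1 := by
      rw [Finset.card_erase_of_mem (Finset.mem_compl.2 haT), Finset.card_compl, Set.powersetCard.card_eq, Fintype.card_fin]
      omega
    obtain ⟨i', hi'⟩ := Finset.card_eq_one.1 hcard
    have hi'mem : i' ∈ ((T : Finset (Fin (j + 3)))ᶜ).erase a := by rw [hi']; exact Finset.mem_singleton_self _
    rw [Finset.mem_erase, Finset.mem_compl] at hi'mem
    obtain ⟨hi'a, hi'T⟩ := hi'mem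
    obtain ⟨k', hk'⟩ := Fin.exists_succAbove_eq hi'a
    refine ⟨k', Finset.mem_univ _, Subtype.ext ?_⟩
    rw [hT']
    ext ν
    rw [Finset.mem_compl, Finset.mem_insert, Finset.mem_singleton, not_or]
    constructor
    · rintro ⟨h1, h2⟩
      by_contra hν
      have hν' : ν ∈ ((T : Finset (Fin (j + 3)))ᶜ).erase a := Finset.mem_erase.2 ⟨h1, Finset.mem_compl.2 hν⟩
      rw [hi', Finset.mem_singleton] at hν'
      exact h2 (hν'.trans hk'.symm)
    · intro hν
      refine ⟨fun h1 ↦ haT (h1 ▸ hν), fun h2 ↦ hi'T ?_⟩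
      rw [← hk']
      rw [h2] at hν
      exact hν
  · intro k' _
    rfl

/-! ## §3 Re-bracketing: `θ^{∧j} ∧ (θ ∧ φ) = (j+1) · (m ∧ φ)` for `m = j! · γ`, `θ^{∧(j+1)} = (j+1)! · γ`; hence `(g−2) · M ≤ S` -/

omit [Fintype ι] [DecidableEq ι] Φ in
/-- **`θ^{∧j} ∧ (θ ∧ φ) = (j+1) · ((j! · γ) ∧ φ)`** when `θ^{∧(j+1)} = (j+1)! · γ` (`θ = ofRealForm η`): re-bracket
`θ^{∧j} ∧ (θ ∧ φ) = (θ^{∧j} ∧ θ) ∧ φ = θ^{∧(j+1)} ∧ φ` (associativity of `∧`, up to the reindexing `2j + (2 + 1) = (2j + 2) + 1`) and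
`(j+1)! = (j+1) · j!`. [cite: Warner1983, 2.6] [cite: Lange2023AbelianVarietiesComplex, §2.5.3 Thm. 2.5.16 (PDF p. 135)] -/
theorem wedgePow_wedge_wedge_eq_domDomCongr_smul_wedge {γ : E [⋀^Fin (2 * j + 2)]→L[ℝ] ℂ}
    (hγ : wedgePow (ofRealForm η) (j + 1) = ((j + 1).factorial : ℂ) • γ) (φ : E [⋀^Fin 1]→L[ℝ] ℂ) :
    (wedgePow (ofRealForm η) j).wedge ((ofRealForm η).wedge φ) =
      (((j + 1 : ℕ) : ℂ) • (((j.factorial : ℂ) • γ).wedge φ)).domDomCongr (finCongr (Nat.add_assoc (2 * j) 2 1)) := by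
  have e1 : (wedgePow (ofRealForm η) j).wedge ((ofRealForm η).wedge φ) =
      (((wedgePow (ofRealForm η) j).wedge (ofRealForm η)).wedge φ).domDomCongr (finCongr (Nat.add_assoc (2 * j) 2 1)) := by
    rw [ContinuousAlternatingMap.WedgeAssoc_holds ℝ E ℂ, domDomCongr_finCongr_trans, domDomCongr_finCongr_self]
  have e2 : ((wedgePow (ofRealForm η) j).wedge (ofRealForm η)).wedge φ = (wedgePow (ofRealForm η) (j + 1)).wedge φ := rfl
  rw [e1, e2, hγ, wedge_smul_left_complex, wedge_smul_left_complex, smul_smul, ← Nat.cast_mul, Nat.factorial_succ]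

omit [Fintype ι] [DecidableEq ι] in
/-- **`θ^{∧(g−2)} ∧ H¹(X, ℤ) ⊆ θ^{∧(g−3)} ∧ H³(X, ℤ)`, elementwise and for every type**: for `φ ∈ H¹(X, ℤ)` and `m = j! · γ`
(`θ^{∧(j+1)} = (j+1)! · γ`, `g = j + 3`), `(j+1) · (m ∧ φ) = θ^{∧j} ∧ (θ ∧ φ) ∈ S = θ^{∧j} ∧ H³(X, ℤ)` (`θ ∧ φ ∈ H³(X, ℤ)` as `θ` is an
integral class). So `(g−2) · M ≤ S`: the cokernel `N/S` restricted to `M` is killed by `g − 2`.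
[cite: Lange2023AbelianVarietiesComplex, §2.5.3 Lemma 2.5.14 and Thm. 2.5.16 (PDF p. 135); §5.4.1 (5.22) (PDF p. 275)] [cite: VoisinHodgeI2002, §7.1.2 (PDF p. 134 L31)] [cite: Warner1983, 2.6] -/
theorem nsmul_smul_wedge_mem_map_wedgePow_wedge_three (hη : IsNSForm Φ η) {γ : E [⋀^Fin (2 * j + 2)]→L[ℝ] ℂ}
    (hγ : wedgePow (ofRealForm η) (j + 1) = ((j + 1).factorial : ℂ) • γ) {φ : E [⋀^Fin 1]→L[ℝ] ℂ}
    (hφ : φ ∈ integralForms Φ 1) :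
    (j + 1) • (((j.factorial : ℂ) • γ).wedge φ) ∈ (integralForms Φ 3).map (AddMonoidHom.mk'
        (fun x : E [⋀^Fin 3]→L[ℝ] ℂ ↦ (wedgePow (ofRealForm η) j).wedge x)
        (ContinuousAlternatingMap.wedge_add_right _)) := by
  refine ⟨(ofRealForm η).wedge φ, wedge_mem_integralForms Φ (ofRealForm_mem_integralForms_two Φ hη) hφ, ?_⟩
  change (wedgePow (ofRealForm η) j).wedge ((ofRealForm η).wedge φ) = _
  rw [wedgePow_wedge_wedge_eq_domDomCongr_smul_wedge hγ φ, ← Nat.cast_smul_eq_nsmul ℂ (j + 1)]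
  rfl

omit [Fintype ι] [DecidableEq ι] in
/-- **`(g−2) · M ≤ S`** as subgroups: `(j+1) · ((j! · γ) ∧ H¹(X, ℤ)) ≤ θ^{∧j} ∧ H³(X, ℤ)` (every type; `θ^{∧(j+1)} = (j+1)! · γ`).
[cite: Lange2023AbelianVarietiesComplex, §2.5.3 Thm. 2.5.16 (PDF p. 135); §5.4.1 (5.22) (PDF p. 275)] [cite: Warner1983, 2.6] -/
theorem map_nsmul_map_smul_wedge_le_map_wedgePow_wedge_three (hη : IsNSForm Φ η) {γ : E [⋀^Fin (2 * j + 2)]→L[ℝ] ℂ}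
    (hγ : wedgePow (ofRealForm η) (j + 1) = ((j + 1).factorial : ℂ) • γ) :
    ((integralForms Φ 1).map (AddMonoidHom.mk'
        (fun φ : E [⋀^Fin 1]→L[ℝ] ℂ ↦ ((((j.factorial : ℂ) • γ).wedge φ : E [⋀^Fin (2 * j + 3)]→L[ℝ] ℂ)))
        (ContinuousAlternatingMap.wedge_add_right _))).map (nsmulAddMonoidHom (j + 1)) ≤
      (integralForms Φ 3).map (AddMonoidHom.mk'
        (fun x : E [⋀^Fin 3]→L[ℝ] ℂ ↦ (wedgePow (ofRealForm η) j).wedge x)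
        (ContinuousAlternatingMap.wedge_add_right _)) := by
  rintro _ ⟨_, ⟨φ, hφ, rfl⟩, rfl⟩
  exact nsmul_smul_wedge_mem_map_wedgePow_wedge_three Φ hη hγ hφ

/-! ## §4 Principal type: `m ∧ φ ∈ θ^{∧j} ∧ H³(X, ℤ) ⟺ φ ∈ (j+1) · H¹(X, ℤ)` — the block-sum functional -/
set_option maxHeartbeats 400000 in -- buildfix (bf3-g27): 160k/180k FAIL, 200k PASS at accept time; line-neutral budget line
/-- **The kernel of `H¹(X, ℤ) → coker θ^{[g−3]}`, `φ ↦ m ∧ φ`** (principal type `(1, …, 1)`, `g = j + 3`, `θ^{∧(j+1)} = (j+1)! · γ`,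
`m = j! · γ = θ^{∧(j+1)}/(j+1)`): for `φ ∈ H¹(X, ℤ)`, **`m ∧ φ ∈ θ^{∧j} ∧ H³(X, ℤ) ⟺ φ ∈ (j+1) · H¹(X, ℤ)`**. `⟸`: §3. `⟹`: in the
free-letter bases `b₃` of `H³(X, ℤ)` and `b₂` of `H^{2j+3}(X, ℤ)` (g37-#2 §4) the matrix of `θ^{∧j} ∧ (−)` is block diagonal with, for each
letter `x₀`, the pair block `B_{x₀} = j! (J − 1)` on the `j + 2` target words `(λμ)_{{a(x₀), i'}ᶜ} ++ (x₀)`; the SUM of the coordinates over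
this block — the block-sum functional `σ_{x₀}` — is `j!(j+1)` on every column of `B_{x₀}` and `0` on all other columns, so
`σ_{x₀} ≡ 0 mod j!(j+1)` on `θ^{∧j} ∧ H³(X, ℤ)`; and `m ∧ dx_x = j! Σ_{i'} dx_{(λμ)_{{a(x), i'}ᶜ} ++ (x)}` (§2) has
`σ_{x₀}(m ∧ dx_x) = [x = x₀] · j!(j+2)`. For `φ = Σ_x φ_x dx_x` with `m ∧ φ ∈ θ^{∧j} ∧ H³(X, ℤ)`: `j!(j+1) ∣ j!(j+2) φ_{x₀}`, so
`(j+1) ∣ φ_{x₀}` (`gcd(j+1, j+2) = 1`) for every letter `x₀`.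
[cite: Lange2023AbelianVarietiesComplex, §5.4.1 Thm. 5.4.1 and (5.22) (PDF p. 275); §2.5.3 Lemma 2.5.14, Thm. 2.5.16, Cor. 2.5.17 (PDF p. 135); §4.2 Poincaré's formula (PDF p. 204); §1.1.3 Exercise 1.1.6 (8)] [cite: VoisinHodgeI2002, §7.1.2 (PDF p. 134 L31)] -/
theorem IsSymplecticEnum.smul_wedge_mem_map_wedgePow_wedge_three_iff (h : IsSymplecticEnum Φ e₀ η d)
    (hη : IsRiemannForm Φ η) (h1 : ∀ i, d i = 1) {γ : E [⋀^Fin (2 * j + 2)]→L[ℝ] ℂ}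
    (hγ : wedgePow (ofRealForm η) (j + 1) = ((j + 1).factorial : ℂ) • γ) {φ : E [⋀^Fin 1]→L[ℝ] ℂ}
    (hφ : φ ∈ integralForms Φ 1) :
    ((j.factorial : ℂ) • γ).wedge φ ∈ (integralForms Φ 3).map (AddMonoidHom.mk'
        (fun x : E [⋀^Fin 3]→L[ℝ] ℂ ↦ (wedgePow (ofRealForm η) j).wedge x)
        (ContinuousAlternatingMap.wedge_add_right _)) ↔
      φ ∈ (integralForms Φ 1).map (nsmulAddMonoidHom (j + 1)) := by
  classical
  refine ⟨fun hS ↦ ?_, ?_⟩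
  swap
  · rintro ⟨ψ, hψ, rfl⟩
    rw [nsmulAddMonoidHom_apply]
    have hms := map_nsmul (AddMonoidHom.mk' (fun ψ : E [⋀^Fin 1]→L[ℝ] ℂ ↦ ((j.factorial : ℂ) • γ).wedge ψ)
      (ContinuousAlternatingMap.wedge_add_right _)) (j + 1) ψ
    simp only [AddMonoidHom.mk'_apply] at hms
    rw [hms]
    exact nsmul_smul_wedge_mem_map_wedgePow_wedge_three Φ hη.isNSForm hγ hψ
  obtain ⟨z, hz, hzφ⟩ := hS
  change (wedgePow (ofRealForm η) j).wedge z = ((j.factorial : ℂ) • γ).wedge φ at hzφ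
  -- the setting of g37-#2 §6
  set θ : E [⋀^Fin (2 * j)]→L[ℝ] ℂ := wedgePow (ofRealForm η) j with hθ
  have hn : 3 + (2 * j + 3) = 2 * (j + 3) := by ring
  have hkl : (2 * j + 3) + 3 = Fintype.card ι := lk_eq_card (ilvEnum e₀) hn
  have hc : 2 * j + 3 = 2 * (j + 1) + 1 := by ring
  letI : LinearOrder ι := linearOrderOfOrientation (ilvEnum e₀)
  have hcardT : ∀ u : {u : Fin 3 → Fin (j + 3) ⊕ Fin (j + 3) // Sum.elim id id (u 0) < Sum.elim id id (u 1) ∧ Sum.elim id id (u 1) < Sum.elim id id (u 2)},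
      ((Finset.univ.image fun m ↦ Sum.elim id id (u.1 m))ᶜ).card = j := fun u ↦ by
    have hmono : StrictMono fun m : Fin 3 ↦ Sum.elim id id (u.1 m) :=
      Fin.strictMono_iff_lt_succ.2 fun m ↦ by
        fin_cases m
        · exact u.2.1
        · exact u.2.2
    rw [Finset.card_compl, Finset.card_image_of_injective _ hmono.injective, Finset.card_univ, Fintype.card_fin,
      Fintype.card_fin]
    omega
  have hcardT' : ∀ (x : Fin (j + 3) ⊕ Fin (j + 3)) (k : Fin (j + 2)),
      (({Sum.elim id id x, (Sum.elim id id x).succAbove k} : Finset (Fin (j + 3)))ᶜ).card = j + 1 := fun x k ↦ by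
    rw [Finset.card_compl, Finset.card_pair (Fin.succAbove_ne _ k).symm, Fintype.card_fin]
    omega
  let T : {u : Fin 3 → Fin (j + 3) ⊕ Fin (j + 3) // Sum.elim id id (u 0) < Sum.elim id id (u 1) ∧ Sum.elim id id (u 1) < Sum.elim id id (u 2)} → Set.powersetCard (Fin (j + 3)) j :=
    fun u ↦ Set.powersetCard.ofCard (hcardT u)
  let T' : Fin (j + 3) ⊕ Fin (j + 3) → Fin (j + 2) → Set.powersetCard (Fin (j + 3)) (j + 1) :=
    fun x k ↦ Set.powersetCard.ofCard (hcardT' x k)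
  obtain ⟨b₃, hb₃l, hb₃r⟩ := exists_basis_integralForms_three_freeLetter Φ e₀
  obtain ⟨b₂, hb₂l, hb₂r⟩ := exists_basis_integralForms_coe_eq_append_ilvWord_freeLetter Φ e₀ hkl T (fun _ ↦ rfl) T'
    (fun _ _ ↦ rfl) hc
  -- `L = θ ∧ (−)` on the lattices and the image vectors `v k = θ ∧ b₃ k`
  set L : (E [⋀^Fin 3]→L[ℝ] ℂ) →+ (E [⋀^Fin (2 * j + 3)]→L[ℝ] ℂ) := AddMonoidHom.mk'
    (fun x : E [⋀^Fin 3]→L[ℝ] ℂ ↦ θ.wedge x) (ContinuousAlternatingMap.wedge_add_right _) with hL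
  let L' : ↥(AddSubgroup.toIntSubmodule (integralForms Φ 3)) →ₗ[ℤ] ↥(AddSubgroup.toIntSubmodule (integralForms Φ (2 * j + 3))) :=
    (AddMonoidHom.mk' (fun x : ↥(AddSubgroup.toIntSubmodule (integralForms Φ 3)) ↦
        (⟨L x.1, wedgePow_wedge_mem_integralForms Φ hη.isNSForm j x.2⟩ :
          ↥(AddSubgroup.toIntSubmodule (integralForms Φ (2 * j + 3)))))
      (fun a b ↦ Subtype.ext (map_add L _ _))).toIntLinearMap
  have hL'coe : ∀ x, ((L' x : ↥(AddSubgroup.toIntSubmodule (integralForms Φ (2 * j + 3)))) : E [⋀^Fin (2 * j + 3)]→L[ℝ] ℂ) =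
      θ.wedge (x : E [⋀^Fin 3]→L[ℝ] ℂ) := fun _ ↦ rfl
  let v : ({u : Fin 3 → Fin (j + 3) ⊕ Fin (j + 3) // Sum.elim id id (u 0) < Sum.elim id id (u 1) ∧ Sum.elim id id (u 1) < Sum.elim id id (u 2)} ⊕ Fin (j + 2) × (Fin (j + 3) ⊕ Fin (j + 3))) →
      ↥(AddSubgroup.toIntSubmodule (integralForms Φ (2 * j + 3))) := fun k ↦ L' (b₃ k)
  have hv : ∀ k, ((v k : ↥(AddSubgroup.toIntSubmodule (integralForms Φ (2 * j + 3)))) : E [⋀^Fin (2 * j + 3)]→L[ℝ] ℂ) =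
      θ.wedge ((b₃ k : ↥(AddSubgroup.toIntSubmodule (integralForms Φ 3))) : E [⋀^Fin 3]→L[ℝ] ℂ) := fun _ ↦ rfl
  -- THE COLUMNS (principal type): a free word goes to `j!` times its target word …
  have hcol_free : ∀ u, v (Sum.inl u) = (j.factorial : ℤ) • b₂ (Sum.inl u) := fun u ↦ by
    apply Subtype.ext
    rw [Submodule.coe_smul, hv, hb₃l, hb₂l, h.wedgePow_wedge_latMonomial_three_free_eq_single Φ u.1 (T u) rfl, smul_smul,
      ← Int.cast_smul_eq_zsmul ℂ (j.factorial : ℤ)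
        (latMonomial Φ (2 * j + 3) (Fin.append (ilvWord e₀ (Set.powersetCard.ofFinEmbEquiv.symm (T u))) (⇑e₀ ∘ u.1)))]
    congr 1
    simp [h1]
  -- … and the pair word `(λ_i, μ_i, x)`, `i = s_{a(x)}(k)`, to `j!` times the sum of the OTHER target words with free letter `x`
  have hcol_pair : ∀ k x, v (Sum.inr (k, x)) =
      ∑ k', (if k' = k then (0 : ℤ) else (j.factorial : ℤ)) • b₂ (Sum.inr (k', x)) := fun k x ↦ by
    apply Subtype.ext
    rw [hv, hb₃r, Submodule.coe_sum, h.wedgePow_wedge_latMonomial_pair_free_eq_sum Φ x k (T' x) (fun _ ↦ rfl) hc,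
      Finset.smul_sum]
    refine Finset.sum_congr rfl fun k' _ ↦ ?_
    rw [Submodule.coe_smul, hb₂r, smul_smul, ← Int.cast_smul_eq_zsmul ℂ (if k' = k then (0 : ℤ) else (j.factorial : ℤ))
      (latMonomial Φ (2 * j + 3) ((Fin.append (ilvWord e₀ (Set.powersetCard.ofFinEmbEquiv.symm (T' x k')))
        (fun _ : Fin 1 ↦ e₀ x)) ∘ Fin.cast hc))]
    congr 1
    by_cases hk : k' = k
    · rw [if_pos hk, if_pos hk, mul_zero, Int.cast_zero]
    · rw [if_neg hk, if_neg hk]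
      simp [h1]
  -- the coordinates of the columns
  have hentry_free : ∀ u q, b₂.repr (v (Sum.inl u)) q = if Sum.inl u = q then (j.factorial : ℤ) else 0 := fun u q ↦ by
    rw [hcol_free, map_zsmul, Basis.repr_self, Finsupp.smul_apply, Finsupp.single_apply, smul_eq_mul, mul_ite, mul_one,
      mul_zero]
  have hentry_pair : ∀ k x q, b₂.repr (v (Sum.inr (k, x))) q =
      Sum.elim (fun _ ↦ (0 : ℤ)) (fun p ↦ if p.2 = x then (if p.1 = k then (0 : ℤ) else (j.factorial : ℤ)) else 0) q :=
      fun k x q ↦ by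
    have hsum : v (Sum.inr (k, x)) =
        ∑ q, (Sum.elim (fun _ ↦ (0 : ℤ)) (fun p : Fin (j + 2) × (Fin (j + 3) ⊕ Fin (j + 3)) ↦
          if p.2 = x then (if p.1 = k then (0 : ℤ) else (j.factorial : ℤ)) else 0) q) • b₂ q := by
      rw [hcol_pair, Fintype.sum_sum_type, Fintype.sum_prod_type]
      simp only [Sum.elim_inl, zero_smul, Finset.sum_const_zero, zero_add, Sum.elim_inr, ite_smul, Finset.sum_ite_eq',
        Finset.mem_univ, if_true]
    rw [hsum, Basis.repr_sum_self]
  -- the `ℤ`-basis `(dx_x)_x` of `H¹(X, ℤ)` indexed by the letters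
  let τ : (Fin (j + 3) ⊕ Fin (j + 3)) ≃ {w : Fin 1 → ι // StrictMono w} :=
    { toFun := fun x ↦ ⟨fun _ ↦ e₀ x, Subsingleton.strictMono _⟩
      invFun := fun w ↦ e₀.symm (w.1 0)
      left_inv := fun x ↦ e₀.symm_apply_apply x
      right_inv := fun w ↦ Subtype.ext (funext fun i ↦ by
        rw [Subsingleton.elim i 0]; exact e₀.apply_symm_apply (w.1 0)) }
  let b₁ : Basis (Fin (j + 3) ⊕ Fin (j + 3)) ℤ ↥(AddSubgroup.toIntSubmodule (integralForms Φ 1)) :=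
    (intLatMonomialBasis Φ 1).reindex τ.symm
  have hb₁ : ∀ x, ((b₁ x : ↥(AddSubgroup.toIntSubmodule (integralForms Φ 1))) : E [⋀^Fin 1]→L[ℝ] ℂ) =
      latMonomial Φ 1 (fun _ ↦ e₀ x) := fun x ↦ by
    rw [Basis.reindex_apply, Equiv.symm_symm, coe_intLatMonomialBasis]; rfl
  have hφsum : φ = ∑ x, ((b₁.repr ⟨φ, hφ⟩ x : ℤ) : ℂ) • latMonomial Φ 1 (fun _ : Fin 1 ↦ e₀ x) := by
    have h0 := congrArg Subtype.val (b₁.sum_repr ⟨φ, hφ⟩)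
    rw [Submodule.coe_sum] at h0
    refine h0.symm.trans (Finset.sum_congr rfl fun x _ ↦ ?_)
    rw [Submodule.coe_smul, hb₁, ← Int.cast_smul_eq_zsmul ℂ (b₁.repr ⟨φ, hφ⟩ x) (latMonomial Φ 1 fun _ : Fin 1 ↦ e₀ x)]
  -- `m ∧ dx_x = j! · Σ_{k'} b₂ (k', x)` (§2, principal type)
  have hwx : ∀ x, ((j.factorial : ℂ) • γ).wedge (latMonomial Φ 1 fun _ : Fin 1 ↦ e₀ x) =
      ((∑ k' : Fin (j + 2), (j.factorial : ℤ) • b₂ (Sum.inr (k', x)) :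
          ↥(AddSubgroup.toIntSubmodule (integralForms Φ (2 * j + 3)))) : E [⋀^Fin (2 * j + 3)]→L[ℝ] ℂ) := fun x ↦ by
    have H := h.wedgePow_wedge_latMonomial_one_eq_sum Φ x (T' x) (fun _ ↦ rfl)
    rw [hγ, wedge_smul_left_complex] at H
    have hfact : ((j + 1).factorial : ℂ) ≠ 0 := Nat.cast_ne_zero.2 (Nat.factorial_ne_zero _)
    have H' := smul_right_injective (E [⋀^Fin (2 * (j + 1) + 1)]→L[ℝ] ℂ) hfact H
    rw [wedge_smul_left_complex, H', Finset.smul_sum, Submodule.coe_sum]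
    refine Finset.sum_congr rfl fun k' _ ↦ ?_
    rw [Submodule.coe_smul, hb₂r, latMonomial_comp_finCast_two_mul_succ₃₈ Φ hc, smul_smul,
      ← Int.cast_smul_eq_zsmul ℂ (j.factorial : ℤ) (latMonomial Φ (2 * (j + 1) + 1)
        (Fin.append (ilvWord e₀ (Set.powersetCard.ofFinEmbEquiv.symm (T' x k'))) (fun _ : Fin 1 ↦ e₀ x)))]
    congr 1
    simp [h1]
  -- `θ ∧ z = m ∧ φ = Σ_x φ_x · (j! Σ_{k'} b₂ (k', x))` in `H^{2j+3}(X, ℤ)`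
  have hLz : L' ⟨z, hz⟩ = ∑ x, (b₁.repr ⟨φ, hφ⟩ x) • ∑ k' : Fin (j + 2), (j.factorial : ℤ) • b₂ (Sum.inr (k', x)) := by
    apply Subtype.ext
    rw [hL'coe, Submodule.coe_sum]
    change θ.wedge z = _
    have hms := map_sum (AddMonoidHom.mk' (fun ψ : E [⋀^Fin 1]→L[ℝ] ℂ ↦ ((j.factorial : ℂ) • γ).wedge ψ)
      (ContinuousAlternatingMap.wedge_add_right _))
      (fun x ↦ ((b₁.repr ⟨φ, hφ⟩ x : ℤ) : ℂ) • latMonomial Φ 1 (fun _ : Fin 1 ↦ e₀ x)) Finset.univ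
    simp only [AddMonoidHom.mk'_apply] at hms
    rw [hzφ]
    conv_lhs => rw [hφsum]
    rw [hms]
    refine Finset.sum_congr rfl fun x _ ↦ ?_
    rw [wedge_smul_right_complex, hwx, Submodule.coe_smul,
      ← Int.cast_smul_eq_zsmul ℂ (b₁.repr ⟨φ, hφ⟩ x)
        (((∑ k' : Fin (j + 2), (j.factorial : ℤ) • b₂ (Sum.inr (k', x)) :
          ↥(AddSubgroup.toIntSubmodule (integralForms Φ (2 * j + 3)))) : E [⋀^Fin (2 * j + 3)]→L[ℝ] ℂ))]
  -- `θ ∧ z` expanded along the columns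
  have hLz' : L' ⟨z, hz⟩ = ∑ k, (b₃.repr ⟨z, hz⟩ k) • v k := by
    conv_lhs => rw [← b₃.sum_repr ⟨z, hz⟩]
    rw [map_sum]
    exact Finset.sum_congr rfl fun k _ ↦ map_smul L' _ _
  -- `Σ_{k'} j! b₂ (k', x)` along ALL basis vectors
  have hw_sum : ∀ x, (∑ k' : Fin (j + 2), (j.factorial : ℤ) • b₂ (Sum.inr (k', x))) =
      ∑ q, (Sum.elim (fun _ ↦ (0 : ℤ)) (fun p : Fin (j + 2) × (Fin (j + 3) ⊕ Fin (j + 3)) ↦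
        if p.2 = x then (j.factorial : ℤ) else 0) q) • b₂ q := fun x ↦ by
    rw [Fintype.sum_sum_type, Fintype.sum_prod_type]
    simp only [Sum.elim_inl, zero_smul, Finset.sum_const_zero, zero_add, Sum.elim_inr, ite_smul, Finset.sum_ite_eq',
      Finset.mem_univ, if_true]
  -- divisibility of every coordinate `φ_{x₀}` by `j + 1`
  have hdvd : ∀ x₀, ((j + 1 : ℕ) : ℤ) ∣ b₁.repr ⟨φ, hφ⟩ x₀ := by
    intro x₀
    -- the block-sum functional of the letter `x₀`
    let σ : ↥(AddSubgroup.toIntSubmodule (integralForms Φ (2 * j + 3))) →ₗ[ℤ] ℤ :=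
      ∑ k' : Fin (j + 2), b₂.coord (Sum.inr (k', x₀))
    have hσapply : ∀ y, σ y = ∑ k' : Fin (j + 2), b₂.repr y (Sum.inr (k', x₀)) := fun y ↦ by
      rw [LinearMap.sum_apply]
      rfl
    -- `σ ≡ 0 mod j!(j+1)` on the columns of `θ ∧ (−)`
    have hσv : ∀ k, ((j.factorial * (j + 1) : ℕ) : ℤ) ∣ σ (v k) := by
      rintro (u | ⟨k, x⟩)
      · rw [hσapply, Finset.sum_eq_zero (fun k' _ ↦ by rw [hentry_free, if_neg Sum.inl_ne_inr])]
        exact dvd_zero _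
      · rw [hσapply]
        simp_rw [hentry_pair, Sum.elim_inr]
        by_cases hx : x₀ = x
        · simp_rw [if_pos hx]
          rw [sum_ite_eq_zero_else₃₈]
          exact ⟨1, by push_cast; ring⟩
        · simp_rw [if_neg hx]
          rw [Finset.sum_const_zero]
          exact dvd_zero _
    have hdivσ : ((j.factorial * (j + 1) : ℕ) : ℤ) ∣ σ (L' ⟨z, hz⟩) := by
      rw [hLz', map_sum]
      exact Finset.dvd_sum fun k _ ↦ by rw [map_smul, smul_eq_mul]; exact dvd_mul_of_dvd_right (hσv k) _
    -- `σ (j! Σ_{k'} b₂ (k', x)) = [x = x₀] · (j+2) j!`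
    have hσw : ∀ x, σ (∑ k' : Fin (j + 2), (j.factorial : ℤ) • b₂ (Sum.inr (k', x))) =
        if x = x₀ then (((j + 2) * j.factorial : ℕ) : ℤ) else 0 := fun x ↦ by
      rw [hσapply, hw_sum x, Basis.repr_sum_self,
        Finset.sum_congr rfl (fun (k' : Fin (j + 2)) _ ↦ (show Sum.elim (fun _ ↦ (0 : ℤ))
          (fun p : Fin (j + 2) × (Fin (j + 3) ⊕ Fin (j + 3)) ↦ if p.2 = x then (j.factorial : ℤ) else 0) (Sum.inr (k', x₀)) =
            if x₀ = x then (j.factorial : ℤ) else 0 from rfl)),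
        Finset.sum_const, Finset.card_univ, Fintype.card_fin, nsmul_eq_mul]
      by_cases hx : x = x₀
      · subst hx
        rw [if_pos rfl, if_pos rfl]
        push_cast
        ring
      · rw [if_neg hx, if_neg (Ne.symm hx), mul_zero]
    have hσLz : σ (L' ⟨z, hz⟩) = b₁.repr ⟨φ, hφ⟩ x₀ * (((j + 2) * j.factorial : ℕ) : ℤ) := by
      rw [hLz, map_sum]
      simp_rw [map_smul, smul_eq_mul, hσw, mul_ite, mul_zero]
      rw [Finset.sum_ite_eq' Finset.univ x₀, if_pos (Finset.mem_univ _)]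
    have h3 : ((j.factorial * (j + 1) : ℕ) : ℤ) ∣ b₁.repr ⟨φ, hφ⟩ x₀ * (((j + 2) * j.factorial : ℕ) : ℤ) := hσLz ▸ hdivσ
    have h4 : (j.factorial : ℤ) * ((j + 1 : ℕ) : ℤ) ∣ (j.factorial : ℤ) * (b₁.repr ⟨φ, hφ⟩ x₀ * ((j + 2 : ℕ) : ℤ)) := by
      convert h3 using 1 <;> push_cast <;> ring
    have hfz : (j.factorial : ℤ) ≠ 0 := by exact_mod_cast Nat.factorial_ne_zero j
    have h5 := (mul_dvd_mul_iff_left hfz).1 h4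
    have hcop : IsCoprime ((j + 1 : ℕ) : ℤ) ((j + 2 : ℕ) : ℤ) := by
      rw [Nat.isCoprime_iff_coprime, show j + 2 = (j + 1) + 1 by ring, Nat.coprime_self_add_right]
      exact Nat.coprime_one_right _
    exact hcop.dvd_of_dvd_mul_right h5
  -- `φ = (j+1) · ψ` with `ψ = Σ_x (φ_x / (j+1)) dx_x ∈ H¹(X, ℤ)`
  let ψ : ↥(AddSubgroup.toIntSubmodule (integralForms Φ 1)) := ∑ x, (b₁.repr ⟨φ, hφ⟩ x / ((j + 1 : ℕ) : ℤ)) • b₁ x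
  have hψ : ((j + 1 : ℕ) : ℤ) • ψ = ⟨φ, hφ⟩ := by
    rw [← b₁.sum_repr ⟨φ, hφ⟩, Finset.smul_sum]
    exact Finset.sum_congr rfl fun x _ ↦ by rw [smul_smul, Int.mul_ediv_cancel' (hdvd x)]
  refine ⟨(ψ : E [⋀^Fin 1]→L[ℝ] ℂ), ψ.2, ?_⟩
  rw [nsmulAddMonoidHom_apply, ← natCast_zsmul, ← Submodule.coe_smul, hψ]

/-! ## §5 Principal type: `N = S ⊔ M`, the exponent `g − 2`, `M ⊄ S` -/

/-- **`[S ⊔ M : S] = [H¹(X, ℤ) : (j+1) · H¹(X, ℤ)] = (j+1)^{2g}`** (principal type, `g = j + 3`, `S = θ^{∧j} ∧ H³(X, ℤ)`,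
`M = m ∧ H¹(X, ℤ)`, `m = j! · γ`, `θ^{∧(j+1)} = (j+1)! · γ`): `[S ⊔ M : S] = [M : M ∩ S]` is the index in `H¹(X, ℤ)` of
`{φ | m ∧ φ ∈ S} = (j+1) · H¹(X, ℤ)` (§4), and `rk H¹(X, ℤ) = 2g`.
[cite: Lange2023AbelianVarietiesComplex, §5.4.1 Thm. 5.4.1 and (5.22) (PDF p. 275); §2.5.3 Thm. 2.5.16 (PDF p. 135); §1.1.3 Exercise 1.1.6 (8)] [cite: VoisinHodgeI2002, §7.1.2 (PDF p. 134 L31)] -/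
theorem IsSymplecticEnum.relIndex_map_wedgePow_wedge_sup_map_smul_wedge_three (h : IsSymplecticEnum Φ e₀ η d)
    (hη : IsRiemannForm Φ η) (h1 : ∀ i, d i = 1) {γ : E [⋀^Fin (2 * j + 2)]→L[ℝ] ℂ}
    (hγ : wedgePow (ofRealForm η) (j + 1) = ((j + 1).factorial : ℂ) • γ) :
    ((integralForms Φ 3).map (AddMonoidHom.mk'
        (fun x : E [⋀^Fin 3]→L[ℝ] ℂ ↦ (wedgePow (ofRealForm η) j).wedge x)
        (ContinuousAlternatingMap.wedge_add_right _))).relIndex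
      ((integralForms Φ 3).map (AddMonoidHom.mk'
        (fun x : E [⋀^Fin 3]→L[ℝ] ℂ ↦ (wedgePow (ofRealForm η) j).wedge x)
        (ContinuousAlternatingMap.wedge_add_right _)) ⊔
       (integralForms Φ 1).map (AddMonoidHom.mk'
        (fun φ : E [⋀^Fin 1]→L[ℝ] ℂ ↦ ((((j.factorial : ℂ) • γ).wedge φ : E [⋀^Fin (2 * j + 3)]→L[ℝ] ℂ)))
        (ContinuousAlternatingMap.wedge_add_right _))) = (j + 1) ^ (2 * (j + 3)) := by
  set S := (integralForms Φ 3).map (AddMonoidHom.mk'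
        (fun x : E [⋀^Fin 3]→L[ℝ] ℂ ↦ (wedgePow (ofRealForm η) j).wedge x)
        (ContinuousAlternatingMap.wedge_add_right _)) with hS
  set L₁ : (E [⋀^Fin 1]→L[ℝ] ℂ) →+ (E [⋀^Fin (2 * j + 3)]→L[ℝ] ℂ) := AddMonoidHom.mk'
    (fun φ : E [⋀^Fin 1]→L[ℝ] ℂ ↦ ((((j.factorial : ℂ) • γ).wedge φ : E [⋀^Fin (2 * j + 3)]→L[ℝ] ℂ)))
    (ContinuousAlternatingMap.wedge_add_right _) with hL₁
  rw [AddSubgroup.relIndex_sup_left, ← AddSubgroup.relIndex_comap, ← AddSubgroup.inf_relIndex_right]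
  have hinf : S.comap L₁ ⊓ integralForms Φ 1 = (integralForms Φ 1).map (nsmulAddMonoidHom (j + 1)) ⊓ integralForms Φ 1 := by
    ext φ
    simp only [AddSubgroup.mem_inf, AddSubgroup.mem_comap]
    constructor
    · rintro ⟨hφS, hφ⟩
      exact ⟨(h.smul_wedge_mem_map_wedgePow_wedge_three_iff Φ hη h1 hγ hφ).1 hφS, hφ⟩
    · rintro ⟨hφN, hφ⟩
      exact ⟨(h.smul_wedge_mem_map_wedgePow_wedge_three_iff Φ hη h1 hγ hφ).2 hφN, hφ⟩
  rw [hinf, AddSubgroup.inf_relIndex_right]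
  haveI := free_integralForms Φ 1
  haveI := finite_integralForms Φ 1
  rw [AddSubgroup.relIndex_map_nsmul]
  congr 1
  refine (finrank_integralForms_eq_choose Φ 1).trans ?_
  rw [← Fintype.card_congr (ilvEnum e₀), Fintype.card_fin, Nat.choose_one_right]

/-- **The cokernel of the divided power `θ^{[g−3]}` is generated by `θ^{[g−2]} ∧ H¹(X, ℤ)`** (principal type, `g = j + 3`): with
`θ^{∧(j+1)} = (j+1)! · γ`, `γ ∈ H^{2j+2}(X, ℤ)`, and `m = j! · γ = θ^{∧(j+1)}/(j+1)`,
**`j! · H^{2j+3}(X, ℤ) = θ^{∧j} ∧ H³(X, ℤ) ⊔ m ∧ H¹(X, ℤ)`** (`N = S ⊔ M`): both `[N : S]` (§1) and `[S ⊔ M : S]` (above) are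
`(j+1)^{2g}` and `S ⊔ M ≤ N` (`m ∧ φ = j! · (γ ∧ φ)`). P.p. fourfold: `H⁵(X, ℤ) = θ ∧ H³(X, ℤ) + θ^{[2]} ∧ H¹(X, ℤ)`; p.p. fivefold:
`2 · H⁷(X, ℤ) = θ^{∧2} ∧ H³(X, ℤ) + 2 θ^{[3]} ∧ H¹(X, ℤ)`.
[cite: Lange2023AbelianVarietiesComplex, §5.4.1 Thm. 5.4.1 and (5.22) (PDF p. 275); §2.5.3 Thm. 2.5.16, Cor. 2.5.17 (PDF p. 135); §4.2 Poincaré's formula (PDF p. 204); §4.7.1 Cor. 4.7.2 (PDF p. 229)] [cite: VoisinHodgeI2002, §7.1.2 (PDF p. 134 L31)] -/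
theorem IsSymplecticEnum.map_nsmul_eq_map_wedgePow_wedge_sup_map_smul_wedge_three (h : IsSymplecticEnum Φ e₀ η d)
    (hη : IsRiemannForm Φ η) (h1 : ∀ i, d i = 1) {γ : E [⋀^Fin (2 * j + 2)]→L[ℝ] ℂ}
    (hγH : γ ∈ integralForms Φ (2 * j + 2)) (hγ : wedgePow (ofRealForm η) (j + 1) = ((j + 1).factorial : ℂ) • γ) :
    (integralForms Φ (2 * j + 3)).map (nsmulAddMonoidHom j.factorial) =
      (integralForms Φ 3).map (AddMonoidHom.mk'
        (fun x : E [⋀^Fin 3]→L[ℝ] ℂ ↦ (wedgePow (ofRealForm η) j).wedge x)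
        (ContinuousAlternatingMap.wedge_add_right _)) ⊔
       (integralForms Φ 1).map (AddMonoidHom.mk'
        (fun φ : E [⋀^Fin 1]→L[ℝ] ℂ ↦ ((((j.factorial : ℂ) • γ).wedge φ : E [⋀^Fin (2 * j + 3)]→L[ℝ] ℂ)))
        (ContinuousAlternatingMap.wedge_add_right _)) := by
  set S := (integralForms Φ 3).map (AddMonoidHom.mk'
        (fun x : E [⋀^Fin 3]→L[ℝ] ℂ ↦ (wedgePow (ofRealForm η) j).wedge x)
        (ContinuousAlternatingMap.wedge_add_right _)) with hS
  set N := (integralForms Φ (2 * j + 3)).map (nsmulAddMonoidHom j.factorial) with hN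
  set M := (integralForms Φ 1).map (AddMonoidHom.mk'
        (fun φ : E [⋀^Fin 1]→L[ℝ] ℂ ↦ ((((j.factorial : ℂ) • γ).wedge φ : E [⋀^Fin (2 * j + 3)]→L[ℝ] ℂ)))
        (ContinuousAlternatingMap.wedge_add_right _)) with hM
  have hSN : S ≤ N := h.map_wedgePow_wedge_integralForms_le_map_nsmul Φ j 3
  have hMN : M ≤ N := by
    rintro _ ⟨φ, hφ, rfl⟩
    refine ⟨γ.wedge φ, wedge_mem_integralForms Φ hγH hφ, ?_⟩
    rw [nsmulAddMonoidHom_apply, AddMonoidHom.mk'_apply, ← Nat.cast_smul_eq_nsmul ℂ j.factorial (γ.wedge φ),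
      wedge_smul_left_complex]
  have hQN : S ⊔ M ≤ N := sup_le hSN hMN
  refine le_antisymm (AddSubgroup.relIndex_eq_one.1 ?_) hQN
  have hmul := AddSubgroup.relIndex_mul_relIndex S (S ⊔ M) N le_sup_left hQN
  rw [h.relIndex_map_wedgePow_wedge_sup_map_smul_wedge_three Φ hη h1 hγ, hN,
    h.relIndex_map_wedgePow_wedge_map_nsmul_three_of_type_one Φ hη h1] at hmul
  exact Nat.eq_of_mul_eq_mul_left (pow_pos (Nat.succ_pos j) _) (hmul.trans (mul_one _).symm)

/-- **The exponent of the cokernel divides `g − 2`**: `(j+1)! · H^{2j+3}(X, ℤ) ⊆ θ^{∧j} ∧ H³(X, ℤ)` on a torus with a symplectic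
enumeration of principal type (`g = j + 3`): `j! x = s + m ∧ φ` (`N = S ⊔ M`) and `(j+1) · (m ∧ φ) ∈ S` (§3). So
`(g−2)! · H^{2g−3}(X, ℤ) ⊆ θ^{∧(g−3)} ∧ H³(X, ℤ) ⊆ (g−3)! · H^{2g−3}(X, ℤ)`; e.g. `2 · H⁵(X, ℤ) ⊆ θ ∧ H³(X, ℤ)` on a p.p. fourfold.
[cite: Lange2023AbelianVarietiesComplex, §5.4.1 Thm. 5.4.1 and (5.22) (PDF p. 275); §2.5.3 Thm. 2.5.16 (PDF p. 135)] [cite: VoisinHodgeI2002, §7.1.2 (PDF p. 134 L31)] -/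
theorem IsSymplecticEnum.map_nsmul_factorial_succ_le_map_wedgePow_wedge_three (h : IsSymplecticEnum Φ e₀ η d)
    (hη : IsRiemannForm Φ η) (h1 : ∀ i, d i = 1) :
    (integralForms Φ (2 * j + 3)).map (nsmulAddMonoidHom (j + 1).factorial) ≤
      (integralForms Φ 3).map (AddMonoidHom.mk'
        (fun x : E [⋀^Fin 3]→L[ℝ] ℂ ↦ (wedgePow (ofRealForm η) j).wedge x)
        (ContinuousAlternatingMap.wedge_add_right _)) := by
  obtain ⟨γ, hγH, hγ⟩ := h.exists_mem_integralForms_wedgePow_eq_factorial_smul Φ (j + 1)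
  rintro _ ⟨x, hx, rfl⟩
  have hxN : j.factorial • x ∈ (integralForms Φ (2 * j + 3)).map (nsmulAddMonoidHom j.factorial) := ⟨x, hx, rfl⟩
  rw [h.map_nsmul_eq_map_wedgePow_wedge_sup_map_smul_wedge_three Φ hη h1 hγH hγ] at hxN
  obtain ⟨s, hs, m, hm, hsm⟩ := AddSubgroup.mem_sup.1 hxN
  rw [nsmulAddMonoidHom_apply, Nat.factorial_succ, mul_nsmul', ← hsm, nsmul_add]
  exact AddSubgroup.add_mem _ (AddSubgroup.nsmul_mem _ hs _)
    (map_nsmul_map_smul_wedge_le_map_wedgePow_wedge_three Φ hη.isNSForm hγ ⟨m, hm, rfl⟩)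

/-- **`M ⊄ S` for `g ≥ 4`**: for `j ≥ 1` (principal type), `m ∧ H¹(X, ℤ) ⊄ θ^{∧j} ∧ H³(X, ℤ)` — otherwise `S ⊔ M = S` would have
index `1 ≠ (j+1)^{2g}`; i.e. the cokernel of `θ^{[g−3]}` on `H³(X, ℤ)` is NON-trivial for every p.p. torus of dimension `≥ 4`
(for a threefold, `j = 0`, it is trivial). [cite: Lange2023AbelianVarietiesComplex, §5.4.1 (5.22) (PDF p. 275); §4.2 (PDF p. 204)] -/
theorem IsSymplecticEnum.not_map_smul_wedge_le_map_wedgePow_wedge_three (h : IsSymplecticEnum Φ e₀ η d)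
    (hη : IsRiemannForm Φ η) (h1 : ∀ i, d i = 1) (hj : 1 ≤ j) {γ : E [⋀^Fin (2 * j + 2)]→L[ℝ] ℂ}
    (hγ : wedgePow (ofRealForm η) (j + 1) = ((j + 1).factorial : ℂ) • γ) :
    ¬ (integralForms Φ 1).map (AddMonoidHom.mk'
        (fun φ : E [⋀^Fin 1]→L[ℝ] ℂ ↦ ((((j.factorial : ℂ) • γ).wedge φ : E [⋀^Fin (2 * j + 3)]→L[ℝ] ℂ)))
        (ContinuousAlternatingMap.wedge_add_right _)) ≤
      (integralForms Φ 3).map (AddMonoidHom.mk'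
        (fun x : E [⋀^Fin 3]→L[ℝ] ℂ ↦ (wedgePow (ofRealForm η) j).wedge x)
        (ContinuousAlternatingMap.wedge_add_right _)) := fun hle ↦ by
  have h2 := h.relIndex_map_wedgePow_wedge_sup_map_smul_wedge_three Φ hη h1 hγ
  rw [sup_eq_left.2 hle, AddSubgroup.relIndex_self] at h2
  have h3 : 1 < (j + 1) ^ (2 * (j + 3)) := Nat.one_lt_pow (by omega) (by omega)
  omega

/-! ## §6 The cokernel as a quotient group: `N/S ≃+ H¹(X, ℤ)/(j+1) · H¹(X, ℤ) ≃+ (ℤ/(j+1))^{2g}` -/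

omit [Fintype ι] [DecidableEq ι] Φ in
/-- **First isomorphism theorem, packaged**: an additive map `f : G → H` into `N ≤ H` with `N = S + f(G)` and `f⁻¹(S) = K` induces
`G/K ≃+ N/S`, `[g] ↦ [f g]`. [folklore] -/
private theorem exists_addEquiv_quotient₃₈ {G H : Type*} [AddCommGroup G] [AddCommGroup H]
    (K : AddSubgroup G) (S N : AddSubgroup H) (f : G →+ H) (hfN : ∀ g, f g ∈ N)
    (hsurj : ∀ y ∈ N, ∃ s ∈ S, ∃ g, s + f g = y) (hker : ∀ g, f g ∈ S ↔ g ∈ K) :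
    ∃ e : G ⧸ K ≃+ ↥N ⧸ S.addSubgroupOf N, ∀ (g : G) (y : ↥N), (y : H) = f g →
      e (QuotientAddGroup.mk g) = QuotientAddGroup.mk y := by
  let Λ : G →+ ↥N := AddMonoidHom.mk' (fun g ↦ ⟨f g, hfN g⟩) (fun a b ↦ Subtype.ext (map_add f a b))
  let Ψ : G →+ ↥N ⧸ S.addSubgroupOf N := (QuotientAddGroup.mk' (S.addSubgroupOf N)).comp Λ
  have hΨ : ∀ g, Ψ g = QuotientAddGroup.mk (Λ g) := fun _ ↦ rfl
  have hΨsurj : Function.Surjective Ψ := by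
    intro q
    obtain ⟨⟨y, hy⟩, rfl⟩ := QuotientAddGroup.mk_surjective q
    obtain ⟨s, hs, g, hsg⟩ := hsurj y hy
    refine ⟨g, ?_⟩
    rw [hΨ, QuotientAddGroup.eq, AddSubgroup.mem_addSubgroupOf]
    change -f g + y ∈ S
    rw [← hsg, add_comm s, ← add_assoc, neg_add_cancel, zero_add]
    exact hs
  have hΨker : Ψ.ker = K := by
    refine AddSubgroup.ext fun g ↦ ?_
    rw [AddMonoidHom.mem_ker, hΨ, QuotientAddGroup.eq_zero_iff, AddSubgroup.mem_addSubgroupOf]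
    exact hker g
  refine ⟨(QuotientAddGroup.quotientAddEquivOfEq hΨker).symm.trans
    (QuotientAddGroup.quotientKerEquivOfSurjective Ψ hΨsurj), fun g y hy ↦ ?_⟩
  have e1 : (QuotientAddGroup.quotientAddEquivOfEq hΨker).symm (QuotientAddGroup.mk g) = QuotientAddGroup.mk g := rfl
  have e2 : QuotientAddGroup.quotientKerEquivOfSurjective Ψ hΨsurj (QuotientAddGroup.mk g) = Ψ g :=
    QuotientAddGroup.kerLift_mk Ψ g
  rw [AddEquiv.trans_apply, e1, e2, hΨ]
  congr 1
  exact Subtype.ext hy.symm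
set_option maxHeartbeats 400000 in -- buildfix (bf3-g27): 160k/180k FAIL, 200k PASS at accept time; line-neutral budget line
/-- **`coker(θ^{[g−3]} : H³(X, ℤ) → H^{2g−3}(X, ℤ)) = N/S ≃+ H¹(X, ℤ)/(g−2) · H¹(X, ℤ)`, induced by `φ ↦ m ∧ φ = (g−3)! · θ^{[g−2]} ∧ φ`**
(principal type, `g = j + 3`, `N = j! · H^{2j+3}(X, ℤ)`, `S = θ^{∧j} ∧ H³(X, ℤ)`, `m = j! · γ`, `θ^{∧(j+1)} = (j+1)! · γ`,
`γ ∈ H^{2j+2}(X, ℤ)`): the homomorphism `H¹(X, ℤ) → N/S`, `φ ↦ [m ∧ φ]` is onto (`N = S ⊔ M`, §5) with kernel `(j+1) · H¹(X, ℤ)`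
(§4) — first isomorphism theorem. The isomorphism `e` is characterised by `e [φ] = [y]` whenever `y = m ∧ φ`.
[cite: Lange2023AbelianVarietiesComplex, §5.4.1 Thm. 5.4.1 and (5.22) (PDF p. 275); §2.5.3 Thm. 2.5.16, Cor. 2.5.17 (PDF p. 135); §4.2 Poincaré's formula (PDF p. 204); §4.7.1 Cor. 4.7.2 (PDF p. 229)] [cite: VoisinHodgeI2002, §7.1.2 (PDF p. 134 L31)] -/
theorem IsSymplecticEnum.exists_addEquiv_quotient_map_wedgePow_wedge_three (h : IsSymplecticEnum Φ e₀ η d)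
    (hη : IsRiemannForm Φ η) (h1 : ∀ i, d i = 1) {γ : E [⋀^Fin (2 * j + 2)]→L[ℝ] ℂ}
    (hγH : γ ∈ integralForms Φ (2 * j + 2)) (hγ : wedgePow (ofRealForm η) (j + 1) = ((j + 1).factorial : ℂ) • γ) :
    ∃ e : ↥(integralForms Φ 1) ⧸ ((integralForms Φ 1).map (nsmulAddMonoidHom (j + 1))).addSubgroupOf (integralForms Φ 1) ≃+
        ↥((integralForms Φ (2 * j + 3)).map (nsmulAddMonoidHom j.factorial)) ⧸
          ((integralForms Φ 3).map (AddMonoidHom.mk'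
        (fun x : E [⋀^Fin 3]→L[ℝ] ℂ ↦ (wedgePow (ofRealForm η) j).wedge x)
        (ContinuousAlternatingMap.wedge_add_right _))).addSubgroupOf
            ((integralForms Φ (2 * j + 3)).map (nsmulAddMonoidHom j.factorial)),
      ∀ (φ : ↥(integralForms Φ 1)) (y : ↥((integralForms Φ (2 * j + 3)).map (nsmulAddMonoidHom j.factorial))),
        (y : E [⋀^Fin (2 * j + 3)]→L[ℝ] ℂ) = ((j.factorial : ℂ) • γ).wedge (φ : E [⋀^Fin 1]→L[ℝ] ℂ) →
          e (QuotientAddGroup.mk φ) = QuotientAddGroup.mk y := by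
  refine exists_addEquiv_quotient₃₈ _ _ _
    (AddMonoidHom.mk' (fun φ : ↥(integralForms Φ 1) ↦
        ((((j.factorial : ℂ) • γ).wedge (φ : E [⋀^Fin 1]→L[ℝ] ℂ) : E [⋀^Fin (2 * j + 3)]→L[ℝ] ℂ)))
      (fun a b ↦ ContinuousAlternatingMap.wedge_add_right _ _ _))
    (fun φ ↦ ?_) (fun y hy ↦ ?_) (fun φ ↦ ?_)
  · -- `m ∧ φ = j! · (γ ∧ φ) ∈ N`
    refine ⟨γ.wedge (φ : E [⋀^Fin 1]→L[ℝ] ℂ), wedge_mem_integralForms Φ hγH φ.2, ?_⟩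
    rw [nsmulAddMonoidHom_apply, AddMonoidHom.mk'_apply,
      ← Nat.cast_smul_eq_nsmul ℂ j.factorial (γ.wedge (φ : E [⋀^Fin 1]→L[ℝ] ℂ)), wedge_smul_left_complex]
  · -- onto: `N = S ⊔ M` (§5)
    have hy' := (h.map_nsmul_eq_map_wedgePow_wedge_sup_map_smul_wedge_three Φ hη h1 hγH hγ).le hy
    obtain ⟨s, hs, _, ⟨φ, hφ, rfl⟩, hsm⟩ := AddSubgroup.mem_sup.1 hy'
    exact ⟨s, hs, ⟨φ, hφ⟩, hsm⟩
  · -- kernel: `(j+1) · H¹(X, ℤ)` (§4)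
    rw [AddSubgroup.mem_addSubgroupOf, AddMonoidHom.mk'_apply]
    exact h.smul_wedge_mem_map_wedgePow_wedge_three_iff Φ hη h1 hγ φ.2

/-- **`coker(θ^{[g−3]} : H³(X, ℤ) → H^{2g−3}(X, ℤ)) ≃+ (ℤ/(g−2))^{2g}`** for a torus with a symplectic enumeration of principal type
(`g = j + 3`; `N/S` with `N = (g−3)! · H^{2g−3}(X, ℤ)`, `S = θ^{∧(g−3)} ∧ H³(X, ℤ)`): `N/S ≃+ H¹(X, ℤ)/(g−2) · H¹(X, ℤ)` (above) and
`H¹(X, ℤ) ≅ ℤ^{2g}` on the basis `(dx_x)_x`. **P.p. abelian fourfold: `H⁵(X, ℤ)/θ ∧ H³(X, ℤ) ≃+ (ℤ/2)^8`**; p.p. fivefold: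
`coker θ^{[2]}|_{H³} ≃+ (ℤ/3)^{10}`. [cite: Lange2023AbelianVarietiesComplex, §5.4.1 Thm. 5.4.1 and (5.22) (PDF p. 275); §2.5.3 Thm. 2.5.16, Cor. 2.5.17 (PDF p. 135); §4.2 Poincaré's formula (PDF p. 204); §1.1.3 Exercise 1.1.6 (8)] [cite: VoisinHodgeI2002, §7.1.2 (PDF p. 134 L31)] -/
theorem IsSymplecticEnum.nonempty_addEquiv_quotient_pi_zmod_three (h : IsSymplecticEnum Φ e₀ η d)
    (hη : IsRiemannForm Φ η) (h1 : ∀ i, d i = 1) :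
    Nonempty (↥((integralForms Φ (2 * j + 3)).map (nsmulAddMonoidHom j.factorial)) ⧸
        ((integralForms Φ 3).map (AddMonoidHom.mk'
        (fun x : E [⋀^Fin 3]→L[ℝ] ℂ ↦ (wedgePow (ofRealForm η) j).wedge x)
        (ContinuousAlternatingMap.wedge_add_right _))).addSubgroupOf
          ((integralForms Φ (2 * j + 3)).map (nsmulAddMonoidHom j.factorial)) ≃+
      (Fin (j + 3) ⊕ Fin (j + 3) → ZMod (j + 1))) := by
  classical
  obtain ⟨γ, hγH, hγ⟩ := h.exists_mem_integralForms_wedgePow_eq_factorial_smul Φ (j + 1)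
  obtain ⟨e, -⟩ := h.exists_addEquiv_quotient_map_wedgePow_wedge_three Φ hη h1 hγH hγ
  -- `H¹(X, ℤ) ≃+ ℤ^{letters}` on the basis `(dx_x)_x`
  letI : LinearOrder ι := linearOrderOfOrientation (ilvEnum e₀)
  let τ : (Fin (j + 3) ⊕ Fin (j + 3)) ≃ {w : Fin 1 → ι // StrictMono w} :=
    { toFun := fun x ↦ ⟨fun _ ↦ e₀ x, Subsingleton.strictMono _⟩
      invFun := fun w ↦ e₀.symm (w.1 0)
      left_inv := fun x ↦ e₀.symm_apply_apply x
      right_inv := fun w ↦ Subtype.ext (funext fun i ↦ by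
        rw [Subsingleton.elim i 0]; exact e₀.apply_symm_apply (w.1 0)) }
  let b₁ : Basis (Fin (j + 3) ⊕ Fin (j + 3)) ℤ ↥(AddSubgroup.toIntSubmodule (integralForms Φ 1)) :=
    (intLatMonomialBasis Φ 1).reindex τ.symm
  let eb : ↥(integralForms Φ 1) ≃+ (Fin (j + 3) ⊕ Fin (j + 3) → ℤ) := b₁.equivFun.toAddEquiv
  have hmap : (((integralForms Φ 1).map (nsmulAddMonoidHom (j + 1))).addSubgroupOf (integralForms Φ 1)).map
      (eb : ↥(integralForms Φ 1) →+ (Fin (j + 3) ⊕ Fin (j + 3) → ℤ)) =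
      (nsmulAddMonoidHom (j + 1) : (Fin (j + 3) ⊕ Fin (j + 3) → ℤ) →+ (Fin (j + 3) ⊕ Fin (j + 3) → ℤ)).range := by
    rw [AddSubgroup.addSubgroupOf_map_nsmulAddMonoidHom_eq_range, AddEquiv.map_range_nsmulAddMonoidHom]
  let e4 : ℤ ⧸ (nsmulAddMonoidHom (j + 1) : ℤ →+ ℤ).range ≃+ ZMod (j + 1) :=
    (QuotientAddGroup.quotientAddEquivOfEq (Int.range_nsmulAddMonoidHom (j + 1))).trans
      (Int.quotientZMultiplesNatEquivZMod (j + 1))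
  exact ⟨e.symm.trans ((QuotientAddGroup.congr _ _ eb hmap).trans
    ((QuotientAddGroup.addEquivPiModRangeNSMulAddMonoidHom (fun _ : Fin (j + 3) ⊕ Fin (j + 3) ↦ ℤ) (j + 1)).trans
      (AddEquiv.piCongrRight fun _ ↦ e4)))⟩

/-! ## §7 Basis-free forms: any presentation of a polarised torus of type `(d₁, …, d_g)`; principal polarisations -/

/-- **The index of the cokernel of `θ^{[g−3]}` on `H³(X, ℤ)` for any polarised torus of type `(d₁, …, d_g)`** (`IsPolarizationType`,
`g = j + 3`; any presentation): `[(g−3)! · H^{2g−3}(X, ℤ) : θ^{∧(g−3)} ∧ H³(X, ℤ)] = ∏_{a<b<c, letters} ∏_{ν ∉ {a,b,c}} d_ν ·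
∏_x (∏_{ν ≠ a(x)} d_ν)^{g−3} (g−2)` (symplectic re-presentation with the same lattice).
[cite: Lange2023AbelianVarietiesComplex, §1.5.1 (PDF p. 51); §5.4.1 Thm. 5.4.1 and (5.22) (PDF p. 275); §2.5.3 Thm. 2.5.16 (PDF p. 135)] [cite: VoisinHodgeI2002, §7.1.2 (PDF p. 134 L31)] -/
theorem IsPolarizationType.relIndex_map_wedgePow_wedge_map_nsmul_three {Φ : (ι → ℝ) ≃L[ℝ] E}
    (hd : IsPolarizationType Φ η d) (hη : IsRiemannForm Φ η) :
    ((integralForms Φ 3).map (AddMonoidHom.mk'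
        (fun x : E [⋀^Fin 3]→L[ℝ] ℂ ↦ (wedgePow (ofRealForm η) j).wedge x)
        (ContinuousAlternatingMap.wedge_add_right _))).relIndex
      ((integralForms Φ (2 * j + 3)).map (nsmulAddMonoidHom j.factorial)) =
      (∏ u : {u : Fin 3 → Fin (j + 3) ⊕ Fin (j + 3) // Sum.elim id id (u 0) < Sum.elim id id (u 1) ∧ Sum.elim id id (u 1) < Sum.elim id id (u 2)},
          ∏ ν ∈ (Finset.univ.image fun m ↦ Sum.elim id id (u.1 m))ᶜ, d ν) *
        ∏ x : Fin (j + 3) ⊕ Fin (j + 3), ((∏ ν ∈ ({Sum.elim id id x} : Finset (Fin (j + 3)))ᶜ, d ν) ^ j * (j + 1)) := by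
  obtain ⟨Φ', hΛ, hs⟩ := hd.exists_isSymplecticEnum Φ
  rw [integralForms_eq_of_range_latticeVec_eq hΛ.symm 3, integralForms_eq_of_range_latticeVec_eq hΛ.symm (2 * j + 3)]
  exact hs.relIndex_map_wedgePow_wedge_map_nsmul_three Φ' (hη.of_range_latticeVec_subset hΛ.le)

/-- **Principal polarisation: `[(g−3)! · H^{2g−3}(X, ℤ) : θ^{∧(g−3)} ∧ H³(X, ℤ)] = (g−2)^{2g}`** (`|ι| = 2g`, `g = j + 3`; any
presentation): the cokernel of the divided power `θ^{[g−3]} : H³(X, ℤ) → H^{2g−3}(X, ℤ)` has order `(g−2)^{2g}`.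
[cite: Lange2023AbelianVarietiesComplex, §2.1.1; §5.4.1 Thm. 5.4.1 and (5.22) (PDF p. 275); §2.5.3 Thm. 2.5.16 (PDF p. 135)] [cite: VoisinHodgeI2002, §7.1.2 (PDF p. 134 L31)] -/
theorem IsPrincipalPolarization.relIndex_map_wedgePow_wedge_map_nsmul_three {Φ : (ι → ℝ) ≃L[ℝ] E}
    (hp : IsPrincipalPolarization Φ η) (hj : Fintype.card ι = 2 * (j + 3)) :
    ((integralForms Φ 3).map (AddMonoidHom.mk'
        (fun x : E [⋀^Fin 3]→L[ℝ] ℂ ↦ (wedgePow (ofRealForm η) j).wedge x)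
        (ContinuousAlternatingMap.wedge_add_right _))).relIndex
      ((integralForms Φ (2 * j + 3)).map (nsmulAddMonoidHom j.factorial)) = (j + 1) ^ (2 * (j + 3)) := by
  obtain ⟨g, d', hd', h1⟩ := hp.exists_type_eq_one
  have hg : j + 3 = g := by have := hd'.card_eq; omega
  obtain ⟨Φ', hΛ, hs⟩ := (hd'.comp_cast hg).exists_isSymplecticEnum Φ
  rw [integralForms_eq_of_range_latticeVec_eq hΛ.symm 3, integralForms_eq_of_range_latticeVec_eq hΛ.symm (2 * j + 3)]
  exact hs.relIndex_map_wedgePow_wedge_map_nsmul_three_of_type_one Φ' (hp.isRiemannForm.of_range_latticeVec_subset hΛ.le)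
    fun i ↦ h1 _

/-- **Principal polarisation: `(g−2)! · H^{2g−3}(X, ℤ) ⊆ θ^{∧(g−3)} ∧ H³(X, ℤ)`** (`|ι| = 2g`, `g = j + 3`; any presentation) — the
cokernel of `θ^{[g−3]}` on `H³(X, ℤ)` is killed by `g − 2`. [cite: Lange2023AbelianVarietiesComplex, §2.1.1; §5.4.1 (5.22) (PDF p. 275); §2.5.3 Thm. 2.5.16 (PDF p. 135)] -/
theorem IsPrincipalPolarization.map_nsmul_factorial_succ_le_map_wedgePow_wedge_three {Φ : (ι → ℝ) ≃L[ℝ] E}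
    (hp : IsPrincipalPolarization Φ η) (hj : Fintype.card ι = 2 * (j + 3)) :
    (integralForms Φ (2 * j + 3)).map (nsmulAddMonoidHom (j + 1).factorial) ≤
      (integralForms Φ 3).map (AddMonoidHom.mk'
        (fun x : E [⋀^Fin 3]→L[ℝ] ℂ ↦ (wedgePow (ofRealForm η) j).wedge x)
        (ContinuousAlternatingMap.wedge_add_right _)) := by
  obtain ⟨g, d', hd', h1⟩ := hp.exists_type_eq_one
  have hg : j + 3 = g := by have := hd'.card_eq; omega
  obtain ⟨Φ', hΛ, hs⟩ := (hd'.comp_cast hg).exists_isSymplecticEnum Φ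
  rw [integralForms_eq_of_range_latticeVec_eq hΛ.symm 3, integralForms_eq_of_range_latticeVec_eq hΛ.symm (2 * j + 3)]
  exact hs.map_nsmul_factorial_succ_le_map_wedgePow_wedge_three Φ' (hp.isRiemannForm.of_range_latticeVec_subset hΛ.le)
    fun i ↦ h1 _

/-- **On a principally polarised complex torus of dimension `g = j + 3` the cokernel of the divided power
`θ^{[g−3]} : H³(X, ℤ) → H^{2g−3}(X, ℤ)` is `H¹(X, ℤ)/(g−2) · H¹(X, ℤ) ≅ (ℤ/(g−2))^{2g}`, generated by `θ^{[g−2]} ∧ H¹(X, ℤ)`**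
(`|ι| = 2g`, any presentation): there is `γ ∈ H^{2g−4}(X, ℤ)` with `θ^{∧(g−2)} = (g−2)! · γ` (`γ = θ^{[g−2]}`) such that, with
`m = (g−3)! · γ`, `(g−3)! · H^{2g−3}(X, ℤ) = θ^{∧(g−3)} ∧ H³(X, ℤ) ⊔ m ∧ H¹(X, ℤ)`; `m ∧ φ ∈ θ^{∧(g−3)} ∧ H³(X, ℤ) ⟺ φ ∈ (g−2) · H¹(X, ℤ)`
for `φ ∈ H¹(X, ℤ)`; and `N/S ≃+ (ℤ/(g−2))^{2g}`. **P.p. abelian fourfold (`j = 1`): `H⁵(X, ℤ) = θ ∧ H³(X, ℤ) ⊔ θ^{[2]} ∧ H¹(X, ℤ)`,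
`θ^{[2]} ∧ φ ∈ θ ∧ H³(X, ℤ) ⟺ φ ∈ 2 H¹(X, ℤ)`, `H⁵(X, ℤ)/θ ∧ H³(X, ℤ) ≅ (ℤ/2)^8`.**
[cite: Lange2023AbelianVarietiesComplex, §2.1.1 (principal = type `(1, …, 1)`); §5.4.1 Thm. 5.4.1 and (5.22) (PDF p. 275); §2.5.3 Thm. 2.5.16, Cor. 2.5.17 (PDF p. 135); §4.2 Poincaré's formula (PDF p. 204); §4.7.1 Cor. 4.7.2 (PDF p. 229); §1.5.1] [cite: VoisinHodgeI2002, §6.2.3 Thm. 6.25 (PDF p. 125); §7.1.2 (PDF p. 134 L31)] -/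
theorem IsPrincipalPolarization.exists_dividedPower_generates_cokernel_three {Φ : (ι → ℝ) ≃L[ℝ] E}
    (hp : IsPrincipalPolarization Φ η) (hj : Fintype.card ι = 2 * (j + 3)) :
    ∃ γ ∈ integralForms Φ (2 * j + 2), wedgePow (ofRealForm η) (j + 1) = ((j + 1).factorial : ℂ) • γ ∧
      (integralForms Φ (2 * j + 3)).map (nsmulAddMonoidHom j.factorial) =
        (integralForms Φ 3).map (AddMonoidHom.mk'
        (fun x : E [⋀^Fin 3]→L[ℝ] ℂ ↦ (wedgePow (ofRealForm η) j).wedge x)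
        (ContinuousAlternatingMap.wedge_add_right _)) ⊔
         (integralForms Φ 1).map (AddMonoidHom.mk'
        (fun φ : E [⋀^Fin 1]→L[ℝ] ℂ ↦ ((((j.factorial : ℂ) • γ).wedge φ : E [⋀^Fin (2 * j + 3)]→L[ℝ] ℂ)))
        (ContinuousAlternatingMap.wedge_add_right _)) ∧
      (∀ φ ∈ integralForms Φ 1, ((j.factorial : ℂ) • γ).wedge φ ∈ (integralForms Φ 3).map (AddMonoidHom.mk'
        (fun x : E [⋀^Fin 3]→L[ℝ] ℂ ↦ (wedgePow (ofRealForm η) j).wedge x)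
        (ContinuousAlternatingMap.wedge_add_right _)) ↔
          φ ∈ (integralForms Φ 1).map (nsmulAddMonoidHom (j + 1))) ∧
      Nonempty (↥((integralForms Φ (2 * j + 3)).map (nsmulAddMonoidHom j.factorial)) ⧸
          ((integralForms Φ 3).map (AddMonoidHom.mk'
        (fun x : E [⋀^Fin 3]→L[ℝ] ℂ ↦ (wedgePow (ofRealForm η) j).wedge x)
        (ContinuousAlternatingMap.wedge_add_right _))).addSubgroupOf
            ((integralForms Φ (2 * j + 3)).map (nsmulAddMonoidHom j.factorial)) ≃+
        (Fin (j + 3) ⊕ Fin (j + 3) → ZMod (j + 1))) := by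
  obtain ⟨g, d', hd', h1⟩ := hp.exists_type_eq_one
  have hg : j + 3 = g := by have := hd'.card_eq; omega
  obtain ⟨Φ', hΛ, hs⟩ := (hd'.comp_cast hg).exists_isSymplecticEnum Φ
  have hη' : IsRiemannForm Φ' η := hp.isRiemannForm.of_range_latticeVec_subset hΛ.le
  have h1' : ∀ i : Fin (j + 3), d' (Fin.cast hg i) = 1 := fun i ↦ h1 _
  obtain ⟨γ, hγH, hγ⟩ := hs.exists_mem_integralForms_wedgePow_eq_factorial_smul Φ' (j + 1)
  refine ⟨γ, ?_, hγ, ?_, fun φ hφ ↦ ?_, ?_⟩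
  · rw [integralForms_eq_of_range_latticeVec_eq hΛ.symm (2 * j + 2)]
    exact hγH
  · rw [integralForms_eq_of_range_latticeVec_eq hΛ.symm 1, integralForms_eq_of_range_latticeVec_eq hΛ.symm 3,
      integralForms_eq_of_range_latticeVec_eq hΛ.symm (2 * j + 3)]
    exact hs.map_nsmul_eq_map_wedgePow_wedge_sup_map_smul_wedge_three Φ' hη' h1' hγH hγ
  · rw [integralForms_eq_of_range_latticeVec_eq hΛ.symm 1] at hφ ⊢
    rw [integralForms_eq_of_range_latticeVec_eq hΛ.symm 3]
    exact hs.smul_wedge_mem_map_wedgePow_wedge_three_iff Φ' hη' h1' hγ hφ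
  · rw [integralForms_eq_of_range_latticeVec_eq hΛ.symm 3, integralForms_eq_of_range_latticeVec_eq hΛ.symm (2 * j + 3)]
    exact hs.nonempty_addEquiv_quotient_pi_zmod_three Φ' hη' h1'

end DegreeThreeCokernel

end Literature.Geometry.Kaehler.ComplexTorus
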